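import Summits.KontsevichZagierPeriods.KontsevichZagierPeriods.Theorems.LinRedNormalFormHoffmanIndependenceSplit
import Summits.KontsevichZagierPeriods.KontsevichZagierPeriods.Theorems.LinRedNormalFormHoffmanIndependenceRungs

/-!
# Crux `HoffmanIndependence` (stmt-KontsevichZagierPeriods-15045), line `weight_split` —
# the truncated exact split, and the crux's own rung ladder typed through weight 5

The crux is the conjunction of its weight truncations
(`hoffmanIndependence_iff_forall_truncation`, `Theorems/…Truncation.lean`: for every `N`, the real
Hoffman values of weight `≤ N` are `ℚ`-linearly independent). This file proves the registered
sub-goal `truncation_iff_initial_and_slices`: EACH truncation splits exactly like the crux does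
(`hoffmanIndependence_iff_subs`) —

  truncation `N` ⟺ (grading rung `N`: the Hoffman spans of weights `≤ N` form a direct sum)
               ∧ (slices `n ≤ N`: within each weight `n ≤ N` the `d_n` Hoffman values are independent),

so the joint rung ladder of the crux is read off the two stubs' ladders. Consequences, with the
landed rungs (`inWeight_of_le_four`, `weightGrading_initial_two`,
`weightGrading_initial_three_iff_zeta_three`, `inWeight_five_iff`):

* `truncation_of_le_two` — truncations `N ≤ 2` hold (`1, ζ(2)`);
* `truncation_three_iff_zeta_three` — truncation 3 ⟺ `ζ(3) ∉ ℚ + ℚπ²` (FIRST OPEN joint rung);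
* `truncation_iff_initial_of_le_four` — truncations `N ≤ 4` are exactly their grading rungs
  (rung 4 ⟺ `ζ(3) ∉ ℚ + ℚπ² + ℚπ⁴`, `weightGrading_initial_four_iff_zeta_three`, `…RungFour.lean`);
* `truncation_five_iff_initial_and_slice` — truncation 5 ⟺ grading rung 5 ∧ `ζ(5) ∉ ℚζ(2)ζ(3)`
  (and truncation 5 ⟺ `1, π², ζ(3), π⁴, ζ(5), π²ζ(3)` independent, `truncation_five_iff`,
  `…TruncationFive.lean`);
* `hoffmanIndependence_iff_forall_initial_and_slices` — the crux ⟺ all grading rungs ∧ all slices.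

Nothing here closes the item; no new definitions. [cite: Zagier1994, §9]
[cite: GoncharovECM2001, Conjecture 1.1]
-/

noncomputable section

namespace Summit.KontsevichZagierPeriods.LinRedNormalForm.HoffmanIndependence

open Literature.NumberTheory.Transcendental MZV
open Summit.KontsevichZagierPeriods.KontsevichZagierPeriods.Theses.LinRedNormalForm (HoffmanIndependence)

/-! ## Bookkeeping inside a truncation -/

/-- For `n ≤ N`, `hoffmanSpan n` is the span of the image, under the truncated family, of the
weight-`n` indices. [folklore] -/
theorem hoffmanSpan_eq_span_image_truncation {n N : ℕ} (hn : n ≤ N) :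
    hoffmanSpan n = Submodule.span ℚ
      ((fun u : {u : List ℕ // IsHoffman u ∧ weight u ≤ N} => multipleZeta u.1) ''
        {u | weight u.1 = n}) := by
  unfold hoffmanSpan
  congr 1
  ext x
  simp only [Set.mem_setOf_eq, Set.mem_image, Subtype.exists, exists_and_left, exists_prop]
  constructor
  · rintro ⟨s, hs, hw, rfl⟩
    exact ⟨s, hw, ⟨hs, hw.le.trans hn⟩, rfl⟩
  · rintro ⟨s, hw, ⟨hs, -⟩, rfl⟩
    exact ⟨s, hs, hw, rfl⟩

/-- Truncations are monotone: weight `≤ N` independence gives weight `≤ M` independence for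
`M ≤ N`. [folklore] -/
theorem truncation_mono {M N : ℕ} (hMN : M ≤ N)
    (h : LinearIndependent ℚ
      (fun u : {u : List ℕ // IsHoffman u ∧ weight u ≤ N} => multipleZeta u.1)) :
    LinearIndependent ℚ
      (fun u : {u : List ℕ // IsHoffman u ∧ weight u ≤ M} => multipleZeta u.1) :=
  h.comp (fun u : {u : List ℕ // IsHoffman u ∧ weight u ≤ M} =>
      (⟨u.1, u.2.1, u.2.2.trans hMN⟩ : {u : List ℕ // IsHoffman u ∧ weight u ≤ N}))
    fun a b hab => Subtype.ext (by have h := congrArg Subtype.val hab; exact h)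

/-! ## The truncated exact split -/

/-- A truncation gives its slices (restriction to one weight `n ≤ N`). [folklore] -/
theorem inWeight_of_truncation {n N : ℕ} (hn : n ≤ N)
    (h : LinearIndependent ℚ
      (fun u : {u : List ℕ // IsHoffman u ∧ weight u ≤ N} => multipleZeta u.1)) :
    LinearIndependent ℚ
      (fun u : {u : List ℕ // IsHoffman u ∧ weight u = n} => multipleZeta u.1) :=
  h.comp (fun u : {u : List ℕ // IsHoffman u ∧ weight u = n} =>
      (⟨u.1, u.2.1, u.2.2.le.trans hn⟩ : {u : List ℕ // IsHoffman u ∧ weight u ≤ N}))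
    fun a b hab => Subtype.ext (by have h := congrArg Subtype.val hab; exact h)

/-- A truncation gives its grading rung: the Hoffman spans of weights `≤ N` are independent
(spans of disjoint sub-families of an independent family are disjoint). [folklore] -/
theorem initial_of_truncation {N : ℕ}
    (h : LinearIndependent ℚ
      (fun u : {u : List ℕ // IsHoffman u ∧ weight u ≤ N} => multipleZeta u.1)) :
    iSupIndep (fun n : {n : ℕ // n ≤ N} => hoffmanSpan n.1) := by
  rw [iSupIndep_def]
  rintro ⟨n, hn⟩
  have hdisj : Disjoint ({u : {u : List ℕ // IsHoffman u ∧ weight u ≤ N} | weight u.1 = n})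
      {u : {u : List ℕ // IsHoffman u ∧ weight u ≤ N} | weight u.1 ≠ n} :=
    Set.disjoint_left.2 fun u hu hu' => hu' hu
  have key := h.disjoint_span_image hdisj
  refine key.mono ?_ ?_
  · exact (hoffmanSpan_eq_span_image_truncation hn).le
  · refine iSup₂_le fun j hj => ?_
    show hoffmanSpan j.1 ≤ _
    rw [hoffmanSpan_eq_span_image_truncation j.2]
    refine Submodule.span_mono (Set.image_mono ?_)
    intro u hu
    exact fun h' => hj (Subtype.ext ((show weight u.1 = j.1 from hu).symm.trans h'))

/-- Grading rung `N` and the slices `n ≤ N` give the truncation `N` (weight-wise independent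
families with independent spans give an independent `Σ`-family, `linearIndependent_iUnion_finite`,
and the truncated index type embeds into the `Σ`-type by `u ↦ ⟨|u|, u⟩`). [folklore] -/
theorem truncation_of_initial_of_slices {N : ℕ}
    (hG : iSupIndep (fun n : {n : ℕ // n ≤ N} => hoffmanSpan n.1))
    (hW : ∀ n ≤ N, LinearIndependent ℚ
      (fun u : {u : List ℕ // IsHoffman u ∧ weight u = n} => multipleZeta u.1)) :
    LinearIndependent ℚ
      (fun u : {u : List ℕ // IsHoffman u ∧ weight u ≤ N} => multipleZeta u.1) := by
  -- the grading hypothesis, rewritten on the spans of the weight-wise ranges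
  have hG' : iSupIndep fun n : {n : ℕ // n ≤ N} => Submodule.span ℚ (Set.range
      fun u : {u : List ℕ // IsHoffman u ∧ weight u = n.1} => multipleZeta u.1) := by
    have hfun : (fun n : {n : ℕ // n ≤ N} => Submodule.span ℚ (Set.range
        fun u : {u : List ℕ // IsHoffman u ∧ weight u = n.1} => multipleZeta u.1)) =
        fun n : {n : ℕ // n ≤ N} => hoffmanSpan n.1 :=
      funext fun n => span_range_hoffman_weight n.1
    rw [hfun]
    exact hG
  -- the Σ-family over the weights `≤ N` is independent
  have hsigma : LinearIndependent ℚ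
      fun ji : Σ n : {n : ℕ // n ≤ N}, {u : List ℕ // IsHoffman u ∧ weight u = n.1} =>
        multipleZeta ji.2.1 :=
    linearIndependent_iUnion_finite
      (f := fun (n : {n : ℕ // n ≤ N}) (u : {u : List ℕ // IsHoffman u ∧ weight u = n.1}) =>
        multipleZeta u.1)
      (fun n => hW n.1 n.2) fun _ _ _ hit => hG'.disjoint_biSup hit
  -- reindex the truncated Hoffman indices by weight
  let e : {u : List ℕ // IsHoffman u ∧ weight u ≤ N} →
      Σ n : {n : ℕ // n ≤ N}, {u : List ℕ // IsHoffman u ∧ weight u = n.1} :=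
    fun u => ⟨⟨weight u.1, u.2.2⟩, ⟨u.1, u.2.1, rfl⟩⟩
  have he : Function.Injective e :=
    Function.Injective.of_comp
      (f := fun ji : Σ n : {n : ℕ // n ≤ N}, {u : List ℕ // IsHoffman u ∧ weight u = n.1} =>
        ji.2.1)
      Subtype.val_injective
  exact hsigma.comp e he

/-- **THE TRUNCATED EXACT SPLIT (registered sub-goal).** For every `N`, the real Hoffman values
of weight `≤ N` are `ℚ`-linearly independent iff (i) the Hoffman spans of weights `≤ N` form a
direct sum in `ℝ` (rung `N` of `stub_weightGrading`) and (ii) within each weight `n ≤ N` the `d_n`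
Hoffman values are independent (slices `≤ N` of `stub_inWeight`). With
`hoffmanIndependence_iff_forall_truncation` this makes the crux's own rung ladder the weight-wise
meet of the two stubs' ladders. [cite: Zagier1994, §9] [cite: GoncharovECM2001, Conjecture 1.1] -/
theorem truncation_iff_initial_and_slices : ∀ N : ℕ, LinearIndependent ℚ (fun u : {u : List ℕ // IsHoffman u ∧ weight u ≤ N} => multipleZeta u.1) ↔ (iSupIndep (fun n : {n : ℕ // n ≤ N} => hoffmanSpan n.1) ∧ ∀ n ≤ N, LinearIndependent ℚ (fun u : {u : List ℕ // IsHoffman u ∧ weight u = n} => multipleZeta u.1)) :=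
  fun _ => ⟨fun h => ⟨initial_of_truncation h, fun _ hn => inWeight_of_truncation hn h⟩,
    fun h => truncation_of_initial_of_slices h.1 h.2⟩

/-- Below weight `5` the slices are theorems (`inWeight_of_le_four`), so a truncation `N ≤ 4` is
exactly its grading rung. [folklore] -/
theorem truncation_iff_initial_of_le_four {N : ℕ} (hN : N ≤ 4) :
    LinearIndependent ℚ
        (fun u : {u : List ℕ // IsHoffman u ∧ weight u ≤ N} => multipleZeta u.1) ↔
      iSupIndep (fun n : {n : ℕ // n ≤ N} => hoffmanSpan n.1) := by
  rw [truncation_iff_initial_and_slices]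
  exact ⟨fun h => h.1, fun h => ⟨h, fun n hn => inWeight_of_le_four (hn.trans hN)⟩⟩

/-! ## The joint rung ladder of the crux, typed through weight 5 -/

/-- **Joint rungs `N ≤ 2` hold**: `1` and `ζ(2)` (and nothing else below weight 3) are
independent. [cite: Lindemann1882] -/
theorem truncation_of_le_two {N : ℕ} (hN : N ≤ 2) :
    LinearIndependent ℚ
      (fun u : {u : List ℕ // IsHoffman u ∧ weight u ≤ N} => multipleZeta u.1) := by
  rw [truncation_iff_initial_of_le_four (hN.trans (by norm_num))]
  exact weightGrading_initial_two.comp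
    (f := fun n : {n : ℕ // n ≤ N} => (⟨n.1, n.2.trans hN⟩ : {n : ℕ // n ≤ 2}))
    fun a b hab => Subtype.ext (by simpa using congrArg Subtype.val hab)

/-- **FIRST OPEN JOINT RUNG, typed: truncation 3 ⟺ `ζ(3) ∉ ℚ + ℚπ²`** (the real Hoffman values
of weight `≤ 3` are `1, ζ(2), ζ(3)`). [cite: Zagier1994, §9] [cite: Apery1979] -/
theorem truncation_three_iff_zeta_three :
    LinearIndependent ℚ
        (fun u : {u : List ℕ // IsHoffman u ∧ weight u ≤ 3} => multipleZeta u.1) ↔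
      ∀ a b : ℚ, multipleZeta [3] ≠ a + b * Real.pi ^ 2 := by
  rw [truncation_iff_initial_of_le_four (by norm_num), weightGrading_initial_three_iff_zeta_three]

/-- **Joint rung 5 = grading rung 5 ∧ slice 5**: the values of weight `≤ 5` are independent iff
the Hoffman spans of weights `≤ 5` form a direct sum AND `ζ(5) ∉ ℚ·ζ(2)ζ(3)` (slice 5,
`inWeight_five_iff`; slices `≤ 4` are theorems). [cite: Zagier1994, §9] -/
theorem truncation_five_iff_initial_and_slice :
    LinearIndependent ℚ
        (fun u : {u : List ℕ // IsHoffman u ∧ weight u ≤ 5} => multipleZeta u.1) ↔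
      iSupIndep (fun n : {n : ℕ // n ≤ 5} => hoffmanSpan n.1) ∧
        ∀ q : ℚ, multipleZeta [5] ≠ q * (multipleZeta [2] * multipleZeta [3]) := by
  rw [truncation_iff_initial_and_slices, ← inWeight_five_iff]
  refine and_congr_right fun _ => ⟨fun h => h 5 le_rfl, fun h5 n hn => ?_⟩
  rcases hn.lt_or_eq with hlt | rfl
  · exact inWeight_of_le_four (Nat.lt_succ_iff.1 hlt)
  · exact h5

/-- **The crux restated on its joint ladder**: `HoffmanIndependence` holds iff every grading rung
and every slice hold — the weight-wise form of `hoffmanIndependence_iff_subs` (with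
`weightGrading_iff_forall_initial`); equivalently (this file + `hoffmanIndependence_iff_forall_truncation`)
iff every truncation holds. [cite: Zagier1994, §9] -/
theorem hoffmanIndependence_iff_forall_initial_and_slices :
    HoffmanIndependence ↔
      (∀ N : ℕ, iSupIndep (fun n : {n : ℕ // n ≤ N} => hoffmanSpan n.1)) ∧
        ∀ n : ℕ, LinearIndependent ℚ
          (fun u : {u : List ℕ // IsHoffman u ∧ weight u = n} => multipleZeta u.1) := by
  rw [hoffmanIndependence_iff_subs, weightGrading_iff_forall_initial]

end Summit.KontsevichZagierPeriods.LinRedNormalForm.HoffmanIndependence
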